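import Literature.NumberTheory.EllipticCurves.OggWildThreeSwanProofs
import Literature.NumberTheory.GaloisRepresentations.CentralInvolutionQuotientProofs
import HarnessLib

/-!
# The wild conductor of `E[ℓ]` above `2` from the central involution `[-1]`:
# `Sw_𝔓(E[ℓ]) = 2 φ_{L/K}(b) = 2 φ_{E/K}(b)`, `b = i(ι) - 1`

`Proofs` file (theorems only, no definitions, no named facts) in topic
`NumberTheory/EllipticCurves`, sequel of `SwanConductorTorsionDichotomyProofs` and of the two
generic bricks `CentralInvolutionBreakProofs`, `CentralInvolutionQuotientProofs`
(`GaloisRepresentations`), landed by the seat of bsd.S15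
(`Literature.NumberTheory.EllipticCurves.conductorNorm_eq_artinConductorNat_of_isElliptic`) as the
**type-free Galois side of Ogg's formula at the additive places above `2` with supersingular
potential good reduction** — the last open case over `ℚ` of Saito's half of Ogg's formula
(Silverman, *Advanced Topics in the Arithmetic of Elliptic Curves*, Thm. IV.11.1; the case `p = 2`
is referred to Saito on PDF p. 366 of the held copy, no printed case analysis exists; the state of
the tree is recorded in `OggFormulaPotGoodOrdinaryTwoProofs`: only `ord₂(j) > 0` remains, where
inertia acts on `E[3]` through a subgroup of `SL₂(𝔽₃)`).

## The statement

Let `E/K` be an elliptic curve over a number field, `ℓ` an odd prime, `v ∣ 2` a place with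
`v ∤ ℓ`, `𝔓 ∣ v` a prime of `\bar ℤ_K`, and `L/K` a finite normal subextension of `K̄` which is
*the* `ℓ`-division field in the sense that `σ ∈ Γ_K` acts trivially on `E[ℓ]` iff `σ|_L = 1`
(`hL`, `hLf`).  Suppose `ι ∈ Gal(L/K)` acts on `E[ℓ]` as `-1` (`hι`; equivalently `ι ≠ 1` fixes
the `x`-coordinates of `E[ℓ]`, `forall_smul_eq_neg_of_forall_smul_eq_or`), and let
`i_{Gal(L/K)}(ι) = b + 1` at `𝔓 ∩ L`.  Then

* `mem_zpowers_of_mem_ramificationSubgroup_one` — **every non-trivial element of the wild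
  inertia group `G₁(𝔓 ∩ L)` has `ι` among its powers**: `G₁` is a `2`-group
  (`isPGroup_ramificationSubgroup_one_of_mem_primesAbove`), so `g ≠ 1` has a power `h` of order
  `2`; a lift `σ ∈ I_𝔓` of `h` fixes `μ_ℓ`, has `σ²` trivial on `E[ℓ]` and moves `E[ℓ]`, hence
  acts as `-1` (`forall_smul_eq_neg_of_sq_smul_eq`: otherwise `T + σT ≠ 0` is a fixed point and
  the Weil-pairing dichotomy `forall_smul_geomTorsion_eq_of_smul_eq_of_ne_zero` makes `σ`
  trivial), i.e. `h = ι` — the unique involution `-1` of `SL₂(𝔽_ℓ)`;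
* `swanConductorAt_torsion_eq_two_mul_herbrandPhi` — **`Sw_𝔓(E[ℓ]) = 2 · φ_{L/K}(b)`**: in
  Silverman's `δ = Σ_{i ≥ 1} (g_i/g_0) codim E[ℓ]^{G_i}` (`swanConductorAt_rationalTate_eq_finsum_ite`,
  *ATAEC* §IV.10, PDF p. 358) the group `G_i` moves `E[ℓ]` iff `G_i ≠ 1` iff `ι ∈ G_i` iff
  `i ≤ b` (`ramificationSubgroup_ne_bot_iff_le_of_lowerIndex_eq`), with codimension `2`, and
  `Σ_{i=1}^{b} g_i/g_0 = φ(b)`; also for `V_ℓ E` (`swanConductorAt_rationalTate_eq_two_mul_herbrandPhi`);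
* `swanConductorAt_torsion_eq_two_mul_herbrandPhi_quotient` — **`Sw_𝔓(E[ℓ]) = 2 · φ_{E/K}(b)`**
  for any normal subextension `E ≤ L` with `σ|_E = 1 ↔ σ|_L ∈ {1, ι}` (the field of
  `x`-coordinates `K(x(E[ℓ])) = L^ι`): Serre's Prop. 15 through the quotient by the central
  involution (`herbrandPhi_eq_herbrandPhi_quotient_of_lowerIndex_eq`), transported to the layer
  `E ≤ L` of `K̄` (`RamificationFiltrationTowerProofs`).

So the wild conductor above `2` of any elliptic curve is reduced to two computations inside
explicit fields, both instances of `lowerIndex_eq_of_smul_eq_neg` (`CentralInvolutionBreakProofs`):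
the break `b = v_{𝔓_L}(2w) - v_{𝔓_L}(w - t)` of the quadratic extension `L = E(w)`,
`w = 2y_P + a₁x_P + a₃`, read off an element `t ∈ E` with `v_{𝔓_L}(w - t)` odd; and
`#Q₀ · φ_{E/K}(b) = b + Σ_{τ ∈ Q₁ ∖ 1} (i_Q(τ) - 1)` (`card_mul_herbrandPhi_eq_of_lowerIndex_eq_of_wild`
for `Q = Gal(E/K)`), where `Q₁ ⊆ PSL₂(𝔽₃) ≅ A₄` is a four-group of involutions for `ℓ = 3`.
For the quaternion families (`#G₁ = 8`, `e₀ = #G₀/#G₁ ∈ {1, 3}`) this reads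
`Sw_𝔓(E[3]) = (b + a₁ + a₂ + a₃)/(2e₀)` with `a_j + 1` the indices of the three involutions of
`Q₁`; e.g. `y² = x³ - x` over `ℚ`: `e₀ = 1`, `a_j = 1`, `b = 3`, `Sw = 3`, `f₂ = 5`, `N = 32`.

## References

* J. H. Silverman, *Advanced Topics in the Arithmetic of Elliptic Curves*, GTM 151 (1994), §IV.10
  (Definition of `δ`, PDF p. 358; Thm. 10.2), §IV.11 (Thm. 11.1; `p = 2`, p. 366).
  [SilvermanATAEC1994]
* J.-P. Serre, *Local Fields*, GTM 67 (1979), Ch. IV §§1–3 (`G_i`, `i_G`, `φ`, Prop. 14–15),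
  Ch. VI §2 (Swan conductor). [SerreLocalFields1979]
* J. H. Silverman, *The Arithmetic of Elliptic Curves*, 2nd ed. (2009), III.8 (Weil pairing).
  [SilvermanAEC2009]
* J.-P. Serre, J. Tate, *Good reduction of abelian varieties*, Ann. of Math. 88 (1968), §3.
  [SerreTate1968]

## Design

No definitions.  `L`, `E` are finite normal intermediate fields of `K̄/K` given with membership /
kernel characterisations (`hL`, `hLf`, `hkerE`) rather than as `K(E[ℓ])`, `K(x(E[ℓ]))`, so that
family files may present them by generators.  `noncomputable section`; namespace
`WeierstrassCurve`; the `ℤ/ℓ`-module structure on `E[ℓ]` is Mathlib's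
`AddSubgroup.torsionBy.zmodModule` (local instance).  Axioms: `propext`, `Classical.choice`,
`Quot.sound`.
-/

noncomputable section

open scoped Classical NumberField
open Field IsDedekindDomain MeasureTheory

universe u

namespace WeierstrassCurve

open Literature.NumberTheory.EllipticCurves Literature.NumberTheory.GaloisRepresentations

attribute [local instance] AddSubgroup.torsionBy.zmodModule

/-! ### `σ = ±1` on `E[ℓ]`: sign dichotomies -/

section Perfect

variable {F : Type u} [Field F] (W : WeierstrassCurve F) (ℓ : ℕ) [Fact ℓ.Prime]

omit [Fact ℓ.Prime] in
/-- For `ℓ` odd, a point `T ∈ E[ℓ]` with `T = -T` is `O` (`2T = 0` and `2` is invertible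
mod `ℓ`). [folklore] -/
theorem geomTorsion_eq_zero_of_eq_neg [Fact ℓ.Prime] (hℓ2 : ℓ ≠ 2) {T : geomTorsion W ℓ}
    (h : T = -T) : T = 0 := by
  have hprime : ℓ.Prime := Fact.out
  have h2 : (2 : ZMod ℓ) ≠ 0 := by
    intro h0
    have h0' : ((2 : ℕ) : ZMod ℓ) = 0 := by exact_mod_cast h0
    rw [ZMod.natCast_eq_zero_iff] at h0'
    have := (Nat.prime_dvd_prime_iff_eq hprime Nat.prime_two).mp h0'
    exact hℓ2 this
  have hTT : (2 : ZMod ℓ) • T = 0 := by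
    rw [two_smul]
    nth_rewrite 1 [h]
    exact neg_add_cancel T
  calc T = ((2 : ZMod ℓ)⁻¹ * 2) • T := by rw [inv_mul_cancel₀ h2, one_smul]
    _ = 0 := by rw [mul_smul, hTT, smul_zero]

omit [Fact ℓ.Prime] in
/-- **An automorphism acting on each point of `E[ℓ]` by a sign acts by one sign** (`ℓ` odd): if
`σT ∈ {T, -T}` for every `T ∈ E[ℓ]`, then either `σ = 1` or `σ = -1` on `E[ℓ]` (the fixed
points and the anti-fixed points are two subgroups with union `E[ℓ]` and intersection `0`).  This
is the step "an automorphism fixing all `x`-coordinates of `E[ℓ]` is `±1`". [folklore] -/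
theorem forall_smul_eq_neg_of_forall_smul_eq_or [Fact ℓ.Prime] (hℓ2 : ℓ ≠ 2)
    {σ : absoluteGaloisGroup F} (h : ∀ T : geomTorsion W ℓ, σ • T = T ∨ σ • T = -T) :
    (∀ T : geomTorsion W ℓ, σ • T = T) ∨ (∀ T : geomTorsion W ℓ, σ • T = -T) := by
  by_contra hcon
  rw [not_or, not_forall, not_forall] at hcon
  obtain ⟨⟨P, hP⟩, ⟨Q, hQ⟩⟩ := hcon
  have hP' : σ • P = -P := (h P).resolve_left hP
  have hQ' : σ • Q = Q := (h Q).resolve_right hQ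
  rcases h (P + Q) with hPQ | hPQ
  · rw [smul_add, hP', hQ', add_left_inj] at hPQ
    -- `-P = P`
    have hP0 : P = 0 := W.geomTorsion_eq_zero_of_eq_neg ℓ hℓ2 hPQ.symm
    apply hP
    rw [hP0, smul_zero]
  · rw [smul_add, hP', hQ', neg_add, add_right_inj] at hPQ
    have hQ0 : Q = 0 := W.geomTorsion_eq_zero_of_eq_neg ℓ hℓ2 hPQ
    apply hQ
    rw [hQ0, smul_zero, neg_zero]

/-- **An element fixing `μ_ℓ`, of square trivial on `E[ℓ]`, and moving `E[ℓ]`, acts as `-1` on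
`E[ℓ]`** (`F` perfect, `E` elliptic, `ℓ ≠ char F` odd).  Otherwise some `T` has `σT ≠ -T`, so
`P = T + σT ≠ O` is fixed by `σ` (`σ² = 1` on `E[ℓ]`), and a subgroup (`⟨σ⟩`) fixing `μ_ℓ`,
acting through elements of order prime to `ℓ` (`σ²` trivial) and fixing `P ≠ O` fixes `E[ℓ]`
(`forall_smul_geomTorsion_eq_of_smul_eq_of_ne_zero`, the Weil-pairing computation
`det ρ̄_ℓ = χ̄_ℓ` of *ATAEC* p. 370 / *AEC* III.8), contradicting `hne`.  Group-theoretically: an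
involution of `SL₂(𝔽_ℓ)` is `-1`.
[cite: SilvermanATAEC1994, proof of Thm. IV.11.1 (PDF p. 370)] [cite: SilvermanAEC2009, Prop. III.8.1] -/
theorem forall_smul_eq_neg_of_sq_smul_eq [PerfectField F] [W.IsElliptic] (hℓ : (ℓ : F) ≠ 0)
    (hℓ2 : ℓ ≠ 2) {σ : absoluteGaloisGroup F}
    (hμ : ∀ t : AlgebraicClosure F, t ^ ℓ = 1 → σ • t = t)
    (h2 : ∀ T : geomTorsion W ℓ, σ • σ • T = T) (hne : ∃ T : geomTorsion W ℓ, σ • T ≠ T) :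
    ∀ T : geomTorsion W ℓ, σ • T = -T := by
  have hprime : ℓ.Prime := Fact.out
  by_contra hcon
  rw [not_forall] at hcon
  obtain ⟨T₀, hT₀⟩ := hcon
  -- the fixed point `P = T₀ + σ T₀ ≠ 0`
  set P : geomTorsion W ℓ := T₀ + σ • T₀ with hPdef
  have hσP : σ • P = P := by rw [hPdef, smul_add, h2, add_comm]
  have hP0 : P ≠ 0 := by
    intro h0
    apply hT₀
    rw [hPdef] at h0
    exact (neg_eq_of_add_eq_zero_right h0).symm
  -- the subgroup `⟨σ⟩`
  set H : Subgroup (absoluteGaloisGroup F) := Subgroup.zpowers σ with hH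
  have hHμ : ∀ τ ∈ H, ∀ t : AlgebraicClosure F, t ^ ℓ = 1 → τ • t = t := by
    intro τ hτ t ht
    have hle : H ≤ MulAction.stabilizer (absoluteGaloisGroup F) t :=
      (Subgroup.zpowers_le (H := MulAction.stabilizer _ t)).mpr (hμ t ht)
    exact hle hτ
  have hHN : ∀ τ ∈ H, ∃ N : ℕ, N.Coprime ℓ ∧ ∀ T : geomTorsion W ℓ, τ ^ N • T = T := by
    intro τ hτ
    refine ⟨2, (Nat.coprime_primes Nat.prime_two hprime).mpr (Ne.symm hℓ2), fun T => ?_⟩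
    obtain ⟨k, rfl⟩ := Subgroup.mem_zpowers_iff.mp hτ
    have hsq : (σ ^ k) ^ 2 = (σ ^ (2 : ℕ)) ^ k := by
      rw [← zpow_natCast, ← zpow_natCast σ 2, ← zpow_mul, ← zpow_mul, mul_comm]
    have hσ2 : σ ^ (2 : ℕ) ∈ MulAction.stabilizer (absoluteGaloisGroup F) T := by
      rw [MulAction.mem_stabilizer_iff, pow_two, mul_smul, h2]
    have hle : Subgroup.zpowers (σ ^ (2 : ℕ)) ≤ MulAction.stabilizer (absoluteGaloisGroup F) T :=
      (Subgroup.zpowers_le (H := MulAction.stabilizer _ T)).mpr hσ2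
    have hmem : (σ ^ (2 : ℕ)) ^ k ∈ Subgroup.zpowers (σ ^ (2 : ℕ)) :=
      Subgroup.zpow_mem _ (Subgroup.mem_zpowers _) k
    rw [hsq]
    exact hle hmem
  have hHP : ∀ τ ∈ H, τ • P = P := by
    intro τ hτ
    have hle : H ≤ MulAction.stabilizer (absoluteGaloisGroup F) P :=
      (Subgroup.zpowers_le (H := MulAction.stabilizer _ P)).mpr hσP
    exact hle hτ
  have hall := W.forall_smul_geomTorsion_eq_of_smul_eq_of_ne_zero ℓ hℓ H hHμ hHN hP0 hHP σ
    (Subgroup.mem_zpowers σ)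
  obtain ⟨T, hT⟩ := hne
  exact hT (hall T)

omit [Fact ℓ.Prime] in
/-- **Coordinates of `σT = -T`.**  If `σ ∈ Γ_F` acts on `T = (x, y) ∈ E[ℓ]` by `σT = -T`, then
`σx = x` and `σy = -y - a₁x - a₃` (`-(x, y) = (x, -y - a₁x - a₃)`, Silverman *AEC* III.2.3).
So an element acting as `-1` on `E[ℓ]` fixes the `x`-coordinates and negates
`w = 2y + a₁x + a₃`. [cite: SilvermanAEC2009, III.2.3 (group law: negation)] -/
theorem smul_coord_of_smul_eq_neg {σ : absoluteGaloisGroup F} {T : geomTorsion W ℓ}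
    (hσ : σ • T = -T) {x y : AlgebraicClosure F}
    {h : (W.baseChange (AlgebraicClosure F)).toAffine.Nonsingular x y}
    (hT : (T : geomPoints W) = Affine.Point.some x y h) :
    σ • x = x ∧ σ • y = -y - (W.baseChange (AlgebraicClosure F)).a₁ * x -
      (W.baseChange (AlgebraicClosure F)).a₃ := by
  have hval : σ • (T : geomPoints W) = -(T : geomPoints W) := by
    have := congrArg (fun P : geomTorsion W ℓ => (P : geomPoints W)) hσ
    rw [AddSubgroup.coe_neg] at this
    exact this
  rw [hT] at hval
  have key : Affine.Point.map ((show AlgebraicClosure F ≃ₐ[F] AlgebraicClosure F from σ) :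
      AlgebraicClosure F →ₐ[F] AlgebraicClosure F) (Affine.Point.some x y h) =
      -Affine.Point.some x y h := hval
  rw [Affine.Point.map_some, Affine.Point.neg_some] at key
  simp only [Affine.Point.some.injEq] at key
  exact ⟨key.1, key.2⟩

omit [Fact ℓ.Prime] in
/-- Conversely, `σT = T` forces `σx = x`, `σy = y` on coordinates. [folklore] -/
theorem smul_coord_of_smul_eq {σ : absoluteGaloisGroup F} {T : geomTorsion W ℓ}
    (hσ : σ • T = T) {x y : AlgebraicClosure F}
    {h : (W.baseChange (AlgebraicClosure F)).toAffine.Nonsingular x y}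
    (hT : (T : geomPoints W) = Affine.Point.some x y h) : σ • x = x ∧ σ • y = y := by
  have hval : σ • (T : geomPoints W) = (T : geomPoints W) :=
    congrArg (fun P : geomTorsion W ℓ => (P : geomPoints W)) hσ
  rw [hT] at hval
  have key : Affine.Point.map ((show AlgebraicClosure F ≃ₐ[F] AlgebraicClosure F from σ) :
      AlgebraicClosure F →ₐ[F] AlgebraicClosure F) (Affine.Point.some x y h) =
      Affine.Point.some x y h := hval
  rw [Affine.Point.map_some] at key
  simp only [Affine.Point.some.injEq] at key
  exact ⟨key.1, key.2⟩

omit [Fact ℓ.Prime] in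
/-- **An automorphism fixing `x(T)` maps `T` to `±T`**: the points of `E` with a given
`x`-coordinate are `(x, y)` and `(x, -y - a₁x - a₃)` (Silverman *AEC* III.2.3).
[cite: SilvermanAEC2009, III.2.3] -/
theorem smul_eq_or_smul_eq_neg_of_smul_x_eq {σ : absoluteGaloisGroup F} {T : geomTorsion W ℓ}
    {x y : AlgebraicClosure F} {h : (W.baseChange (AlgebraicClosure F)).toAffine.Nonsingular x y}
    (hT : (T : geomPoints W) = Affine.Point.some x y h) (hx : σ • x = x) :
    σ • T = T ∨ σ • T = -T := by
  -- the image point `σT = (σx, σy)`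
  have hval : ((σ • T : geomTorsion W ℓ) : geomPoints W) =
      Affine.Point.map ((show AlgebraicClosure F ≃ₐ[F] AlgebraicClosure F from σ) :
        AlgebraicClosure F →ₐ[F] AlgebraicClosure F) (Affine.Point.some x y h) := by
    rw [← hT]; rfl
  rw [Affine.Point.map_some] at hval
  obtain ⟨x', y', h', hP'⟩ : ∃ x' y' h',
      ((σ • T : geomTorsion W ℓ) : geomPoints W) = Affine.Point.some x' y' h' := ⟨_, _, _, hval⟩
  obtain ⟨hx', -⟩ := Affine.Point.some.inj (hP'.symm.trans hval)
  have hxx : x' = x := hx'.trans hx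
  -- `(x, y')` lies on the curve, so `y' ∈ {y, -y - a₁x - a₃}`
  subst hxx
  rcases Affine.Y_eq_of_X_eq h'.left h.left rfl with hyy | hyy
  · left
    apply Subtype.ext
    rw [hP', hT]
    subst hyy
    rfl
  · right
    apply Subtype.ext
    rw [AddSubgroup.coe_neg]
    change ((σ • T : geomTorsion W ℓ) : geomPoints W) = -(T : geomPoints W)
    rw [hP', hT]
    refine Eq.trans ?_ (Affine.Point.neg_some h).symm
    subst hyy
    rfl

end Perfect

/-! ### Number fields: the `ℓ`-division field at a prime above `2` -/

section NumberField

variable {K : Type u} [Field K] [NumberField K] (W : WeierstrassCurve K) (ℓ : ℕ) [Fact ℓ.Prime]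

omit [NumberField K] [Fact ℓ.Prime] in
/-- `σ⁻¹` acts as `-1` on `E[ℓ]` if `σ` does. [folklore] -/
theorem inv_smul_eq_neg_of_smul_eq_neg {σ : absoluteGaloisGroup K}
    (h : ∀ T : geomTorsion W ℓ, σ • T = -T) (T : geomTorsion W ℓ) : σ⁻¹ • T = -T := by
  have := h (σ⁻¹ • T)
  rw [smul_inv_smul] at this
  rw [← neg_neg (σ⁻¹ • T), ← this]

/-- **A wild inertia involution of the `ℓ`-division field acts as `-1` on `E[ℓ]`.**  Let `E/K`
be elliptic, `ℓ` an odd prime with `ℓ ∉ v`, `𝔓 ∣ v`, `L/K` finite normal in `K̄` with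
`σ|_L = 1 ↔ σ` fixes `E[ℓ]` (`hL`, `hLf`), and `h ∈ G₁(𝔓 ∩ L)` with `h ≠ 1`, `h² = 1`.  Then
every `σ ∈ Γ_K` restricting to `h` acts as `-1` on `E[ℓ]`: `h` lifts to `σ' ∈ I_𝔓`
(Serre I §7 Prop. 22), which fixes `μ_ℓ`, satisfies `σ'² = 1` on `E[ℓ]` and moves `E[ℓ]`
(faithfulness), hence acts as `-1` (`forall_smul_eq_neg_of_sq_smul_eq`), and `σ'⁻¹σ` fixes `E[ℓ]`.
Group-theoretically: an involution of the inertia group, which lies in `SL₂(𝔽_ℓ)`, is `-1`.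
[cite: SerreLocalFields1979, Ch. I §7 Prop. 22] [cite: SilvermanATAEC1994, proof of Thm. IV.11.1 (PDF p. 370)] -/
theorem smul_eq_neg_of_mem_ramificationSubgroup_one_of_mul_self_eq_one [W.IsElliptic]
    (hℓ2 : ℓ ≠ 2) {v : HeightOneSpectrum (𝓞 K)} (hℓ : (ℓ : 𝓞 K) ∉ v.asIdeal)
    {𝔓 : Ideal (absIntegers (𝓞 K) K)} (h𝔓 : 𝔓 ∈ v.primesAbove)
    (L : IntermediateField K (AlgebraicClosure K)) [FiniteDimensional K L] [Normal K L]
    (hL : ∀ σ : absoluteGaloisGroup K, absRestrictNormalHom L σ = 1 →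
      ∀ T : geomTorsion W ℓ, σ • T = T)
    (hLf : ∀ σ : absoluteGaloisGroup K, (∀ T : geomTorsion W ℓ, σ • T = T) →
      absRestrictNormalHom L σ = 1)
    {h : L ≃ₐ[K] L}
    (hhG1 : h ∈ (𝔓.comap (L.integralClosureToAbsIntegers (𝓞 K))).ramificationSubgroup
      (L ≃ₐ[K] L) 1)
    (hh1 : h ≠ 1) (hh2 : h * h = 1) :
    ∀ σ : absoluteGaloisGroup K, absRestrictNormalHom L σ = h →
      ∀ T : geomTorsion W ℓ, σ • T = -T := by
  have hprime : ℓ.Prime := Fact.out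
  have hℓK : (ℓ : K) ≠ 0 := Nat.cast_ne_zero.mpr hprime.ne_zero
  haveI : 𝔓.IsPrime := h𝔓.1
  have hh0 : h ∈ (𝔓.comap (L.integralClosureToAbsIntegers (𝓞 K))).inertia (L ≃ₐ[K] L) :=
    Ideal.ramificationSubgroup_le_inertia _ _ 1 hhG1
  -- lift `h` to an inertia element `σ'`
  obtain ⟨⟨σ', hσ'I⟩, hσ'⟩ := inertia_comap_le_range_absRestrictNormalHom 𝔓 L hh0
  rw [MonoidHom.comp_apply, Subgroup.subtype_apply] at hσ'
  have hμ : ∀ t : AlgebraicClosure K, t ^ ℓ = 1 → σ' • t = t := fun t ht ↦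
    smul_eq_self_of_mem_inertia_of_pow_prime_pow_eq_one (ℓ := ℓ) (n := 1) hℓ h𝔓 hσ'I
      (by rw [pow_one]; exact ht)
  have h2 : ∀ T : geomTorsion W ℓ, σ' • σ' • T = T := by
    intro T
    rw [← mul_smul]
    exact hL (σ' * σ') (by rw [map_mul, hσ', hh2]) T
  have hne : ∃ T : geomTorsion W ℓ, σ' • T ≠ T := by
    by_contra hall
    push Not at hall
    have := hLf σ' hall
    rw [hσ'] at this
    exact hh1 this
  have hneg := W.forall_smul_eq_neg_of_sq_smul_eq ℓ hℓK hℓ2 hμ h2 hne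
  -- any other lift differs by an element trivial on `E[ℓ]`
  intro σ hσ T
  have hfix : ∀ T : geomTorsion W ℓ, (σ'⁻¹ * σ) • T = T :=
    hL _ (by rw [map_mul, map_inv, hσ', hσ, inv_mul_cancel])
  have := hfix T
  rw [mul_smul, inv_smul_eq_iff] at this
  rw [this, hneg T]

/-- **If the `ℓ`-division field is wildly ramified at `𝔓 ∣ 2`, some wild inertia element acts as
`-1` on `E[ℓ]`**: `G₁(𝔓 ∩ L)` is a `2`-group (Serre IV §2 Cor. 3), so it contains an involution
`ι` as soon as it is non-trivial, and `ι` acts as `-1`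
(`smul_eq_neg_of_mem_ramificationSubgroup_one_of_mul_self_eq_one`).  This produces the element
`ι` of the main theorems without constructing automorphisms.
[cite: SerreLocalFields1979, Ch. IV §2 Cor. 3 of Prop. 7] [cite: SilvermanATAEC1994, proof of Thm. IV.11.1 (PDF p. 370)] -/
theorem exists_smul_eq_neg_of_ramificationSubgroup_one_ne_bot [W.IsElliptic]
    {v : HeightOneSpectrum (𝓞 K)} (hv2 : (2 : 𝓞 K) ∈ v.asIdeal) (hℓ : (ℓ : 𝓞 K) ∉ v.asIdeal)
    {𝔓 : Ideal (absIntegers (𝓞 K) K)} (h𝔓 : 𝔓 ∈ v.primesAbove)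
    (L : IntermediateField K (AlgebraicClosure K)) [FiniteDimensional K L] [Normal K L]
    (hL : ∀ σ : absoluteGaloisGroup K, absRestrictNormalHom L σ = 1 →
      ∀ T : geomTorsion W ℓ, σ • T = T)
    (hLf : ∀ σ : absoluteGaloisGroup K, (∀ T : geomTorsion W ℓ, σ • T = T) →
      absRestrictNormalHom L σ = 1)
    (hne : (𝔓.comap (L.integralClosureToAbsIntegers (𝓞 K))).ramificationSubgroup (L ≃ₐ[K] L) 1
      ≠ ⊥) :
    ∃ ι ∈ (𝔓.comap (L.integralClosureToAbsIntegers (𝓞 K))).ramificationSubgroup (L ≃ₐ[K] L) 1,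
      ι ≠ 1 ∧ ι * ι = 1 ∧
      ∀ σ : absoluteGaloisGroup K, absRestrictNormalHom L σ = ι →
        ∀ T : geomTorsion W ℓ, σ • T = -T := by
  haveI : 𝔓.IsPrime := h𝔓.1
  haveI : IsGalois K L := {}
  have hℓ2 : ℓ ≠ 2 := by
    rintro rfl
    exact hℓ (by exact_mod_cast hv2)
  -- the residue characteristic is `2`, so `G₁` is a `2`-group
  set p := ringChar (𝓞 K ⧸ v.asIdeal) with hp
  have hpprime : p.Prime := by
    haveI : Finite (𝓞 K ⧸ v.asIdeal) := Ideal.finiteQuotientOfFreeOfNeBot v.asIdeal v.ne_bot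
    exact CharP.char_is_prime (𝓞 K ⧸ v.asIdeal) p
  have hp2 : p = 2 := by
    have h0 : ((2 : ℕ) : 𝓞 K ⧸ v.asIdeal) = 0 := by
      rw [← map_natCast (Ideal.Quotient.mk v.asIdeal), Ideal.Quotient.eq_zero_iff_mem]
      exact_mod_cast hv2
    have hdvd : p ∣ 2 := (ringChar.spec _ _).mp h0
    exact (Nat.prime_dvd_prime_iff_eq hpprime Nat.prime_two).mp hdvd
  haveI : Fact p.Prime := ⟨hpprime⟩
  have hG1 : IsPGroup p ((𝔓.comap (L.integralClosureToAbsIntegers (𝓞 K))).ramificationSubgroup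
      (L ≃ₐ[K] L) 1) := isPGroup_ramificationSubgroup_one_of_mem_primesAbove h𝔓 L
  obtain ⟨g, hg1⟩ := (Subgroup.ne_bot_iff_exists_ne_one).mp hne
  have hg : (g : L ≃ₐ[K] L) ∈ _ := g.2
  have hg1' : (g : L ≃ₐ[K] L) ≠ 1 := fun h1 => hg1 (Subtype.ext h1)
  -- the order of `g` is `2^k`, `k ≥ 1`; `h = g^(2^(k-1))` is an involution of `G₁`
  obtain ⟨k, hk⟩ := IsPGroup.iff_orderOf.mp hG1 g
  rw [Subgroup.orderOf_mk, hp2] at hk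
  have hk1 : 1 ≤ k := by
    by_contra hk0
    push Not at hk0
    have : k = 0 := by omega
    rw [this, pow_zero, orderOf_eq_one_iff] at hk
    exact hg1' hk
  set h : L ≃ₐ[K] L := (g : L ≃ₐ[K] L) ^ 2 ^ (k - 1) with hh
  have hh2 : h * h = 1 := by
    rw [hh, ← pow_add, ← two_mul, ← pow_succ', Nat.sub_add_cancel hk1, ← hk, pow_orderOf_eq_one]
  have hh1 : h ≠ 1 := by
    intro h1
    have hdvd : orderOf (g : L ≃ₐ[K] L) ∣ 2 ^ (k - 1) :=
      orderOf_dvd_of_pow_eq_one (by rw [← hh, h1])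
    rw [hk, Nat.pow_dvd_pow_iff_le_right (by norm_num)] at hdvd
    omega
  have hhG1 : h ∈ (𝔓.comap (L.integralClosureToAbsIntegers (𝓞 K))).ramificationSubgroup
      (L ≃ₐ[K] L) 1 := Subgroup.pow_mem _ hg _
  exact ⟨h, hhG1, hh1, hh2,
    W.smul_eq_neg_of_mem_ramificationSubgroup_one_of_mul_self_eq_one ℓ hℓ2 hℓ h𝔓 L hL hLf
      hhG1 hh1 hh2⟩

/-- **In residue characteristic `2`, every non-trivial wild inertia element of the `ℓ`-division
field has the central involution among its powers.**  Let `E/K` be elliptic, `ℓ` a prime,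
`v` a place with `2 ∈ v`, `ℓ ∉ v`, `𝔓 ∣ v`, `L/K` finite normal in `K̄` with
`σ|_L = 1 ↔ σ` fixes `E[ℓ]` (`hL`, `hLf`), and `ι ∈ Gal(L/K)` acting as `-1` on `E[ℓ]` (`hι`).
Then for every `g ≠ 1` in `G₁(𝔓 ∩ L)`, `ι ∈ ⟨g⟩`: `G₁` is a `2`-group (Serre IV §2 Cor. 3), so
some power `h` of `g` has order `2`; `h` lifts to `σ ∈ I_𝔓` (Serre I §7 Prop. 22), which fixes
`μ_ℓ`, satisfies `σ² = 1` on `E[ℓ]` and moves `E[ℓ]` (faithfulness), hence acts as `-1`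
(`forall_smul_eq_neg_of_sq_smul_eq`), so `h = ι` by faithfulness.
[cite: SerreLocalFields1979, Ch. IV §2 Cor. 3 of Prop. 7 and Ch. I §7 Prop. 22]
[cite: SilvermanATAEC1994, proof of Thm. IV.11.1 (PDF p. 370)] -/
theorem mem_zpowers_of_mem_ramificationSubgroup_one [W.IsElliptic]
    {v : HeightOneSpectrum (𝓞 K)} (hv2 : (2 : 𝓞 K) ∈ v.asIdeal) (hℓ : (ℓ : 𝓞 K) ∉ v.asIdeal)
    {𝔓 : Ideal (absIntegers (𝓞 K) K)} (h𝔓 : 𝔓 ∈ v.primesAbove)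
    (L : IntermediateField K (AlgebraicClosure K)) [FiniteDimensional K L] [Normal K L]
    (hL : ∀ σ : absoluteGaloisGroup K, absRestrictNormalHom L σ = 1 →
      ∀ T : geomTorsion W ℓ, σ • T = T)
    (hLf : ∀ σ : absoluteGaloisGroup K, (∀ T : geomTorsion W ℓ, σ • T = T) →
      absRestrictNormalHom L σ = 1)
    {ι : L ≃ₐ[K] L}
    (hι : ∀ σ : absoluteGaloisGroup K, absRestrictNormalHom L σ = ι →
      ∀ T : geomTorsion W ℓ, σ • T = -T) :
    ∀ g ∈ (𝔓.comap (L.integralClosureToAbsIntegers (𝓞 K))).ramificationSubgroup (L ≃ₐ[K] L) 1,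
      g ≠ 1 → ι ∈ Subgroup.zpowers g := by
  have hprime : ℓ.Prime := Fact.out
  have hℓK : (ℓ : K) ≠ 0 := Nat.cast_ne_zero.mpr hprime.ne_zero
  haveI : 𝔓.IsPrime := h𝔓.1
  haveI : IsGalois K L := {}
  -- `ℓ ≠ 2`
  have hℓ2 : ℓ ≠ 2 := by
    rintro rfl
    exact hℓ (by exact_mod_cast hv2)
  -- the residue characteristic is `2`, so `G₁` is a `2`-group
  set p := ringChar (𝓞 K ⧸ v.asIdeal) with hp
  have hpprime : p.Prime := by
    haveI : Finite (𝓞 K ⧸ v.asIdeal) := Ideal.finiteQuotientOfFreeOfNeBot v.asIdeal v.ne_bot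
    exact CharP.char_is_prime (𝓞 K ⧸ v.asIdeal) p
  have hp2 : p = 2 := by
    have h0 : ((2 : ℕ) : 𝓞 K ⧸ v.asIdeal) = 0 := by
      rw [← map_natCast (Ideal.Quotient.mk v.asIdeal), Ideal.Quotient.eq_zero_iff_mem]
      exact_mod_cast hv2
    have hdvd : p ∣ 2 := (ringChar.spec _ _).mp h0
    exact (Nat.prime_dvd_prime_iff_eq hpprime Nat.prime_two).mp hdvd
  haveI : Fact p.Prime := ⟨hpprime⟩
  set G : ℕ → Subgroup (L ≃ₐ[K] L) := fun j ↦
    (𝔓.comap (L.integralClosureToAbsIntegers (𝓞 K))).ramificationSubgroup (L ≃ₐ[K] L) j with hG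
  have hG1 : IsPGroup p (G 1) := isPGroup_ramificationSubgroup_one_of_mem_primesAbove h𝔓 L
  intro g hg hg1
  -- the order of `g` is `2^k`, `k ≥ 1`
  obtain ⟨k, hk⟩ := IsPGroup.iff_orderOf.mp hG1 ⟨g, hg⟩
  rw [Subgroup.orderOf_mk, hp2] at hk
  have hk1 : 1 ≤ k := by
    by_contra hk0
    push Not at hk0
    have : k = 0 := by omega
    rw [this, pow_zero, orderOf_eq_one_iff] at hk
    exact hg1 hk
  -- `h = g^(2^(k-1))` has order `2`
  set h : L ≃ₐ[K] L := g ^ 2 ^ (k - 1) with hh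
  have hh2 : h * h = 1 := by
    rw [hh, ← pow_add, ← two_mul, ← pow_succ', Nat.sub_add_cancel hk1, ← hk, pow_orderOf_eq_one]
  have hh1 : h ≠ 1 := by
    intro h1
    have hdvd : orderOf g ∣ 2 ^ (k - 1) := orderOf_dvd_of_pow_eq_one (by rw [← hh, h1])
    rw [hk, Nat.pow_dvd_pow_iff_le_right (by norm_num)] at hdvd
    omega
  have hhG1 : h ∈ G 1 := Subgroup.pow_mem _ hg _
  have hneg := W.smul_eq_neg_of_mem_ramificationSubgroup_one_of_mul_self_eq_one ℓ hℓ2 hℓ h𝔓 L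
    hL hLf hhG1 hh1 hh2
  -- compare a lift of `h` with a lift of `ι`
  obtain ⟨σ', hσ'⟩ := absRestrictNormalHom_surjective' L h
  obtain ⟨τ, hτ⟩ := absRestrictNormalHom_surjective' L ι
  have hτneg := hι τ hτ
  have hfix : ∀ T : geomTorsion W ℓ, (τ⁻¹ * σ') • T = T := by
    intro T
    rw [mul_smul, hneg σ' hσ' T, smul_neg, W.inv_smul_eq_neg_of_smul_eq_neg ℓ hτneg T, neg_neg]
  have h1 := hLf _ hfix
  rw [map_mul, map_inv, hτ, hσ', inv_mul_eq_one] at h1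
  -- `ι = h = g^(2^(k-1)) ∈ ⟨g⟩`
  rw [h1, hh]
  exact Subgroup.pow_mem _ (Subgroup.mem_zpowers g) _

/-- `ι ≠ 1` for `ι ∈ Gal(L/K)` acting as `-1` on `E[ℓ]` (`ℓ` odd, `E` elliptic: `E[ℓ] ≠ 0` has
a point `T ≠ -T`). [folklore] -/
theorem ne_one_of_smul_eq_neg [W.IsElliptic] (hℓ2 : ℓ ≠ 2)
    (L : IntermediateField K (AlgebraicClosure K)) [FiniteDimensional K L] [Normal K L]
    (hL : ∀ σ : absoluteGaloisGroup K, absRestrictNormalHom L σ = 1 →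
      ∀ T : geomTorsion W ℓ, σ • T = T)
    {ι : L ≃ₐ[K] L}
    (hι : ∀ σ : absoluteGaloisGroup K, absRestrictNormalHom L σ = ι →
      ∀ T : geomTorsion W ℓ, σ • T = -T) : ι ≠ 1 := by
  have hprime : ℓ.Prime := Fact.out
  have hℓK : (ℓ : K) ≠ 0 := Nat.cast_ne_zero.mpr hprime.ne_zero
  haveI : Finite (geomTorsion W ℓ) := W.finite_geomTorsion_nat hprime.ne_zero
  haveI : Module.Finite (ZMod ℓ) (geomTorsion W ℓ) := Module.Finite.of_finite
  obtain ⟨T, hT0⟩ : ∃ T : geomTorsion W ℓ, T ≠ 0 := by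
    rw [← Module.finrank_pos_iff_exists_ne_zero (R := ZMod ℓ), W.finrank_geomTorsion_eq_two ℓ hℓK]
    exact Nat.zero_lt_two
  intro h1
  obtain ⟨τ, hτ⟩ := absRestrictNormalHom_surjective' L ι
  have hneg := hι τ hτ T
  rw [hL τ (by rw [hτ, h1])] at hneg
  exact hT0 (W.geomTorsion_eq_zero_of_eq_neg ℓ hℓ2 hneg)

/-- **The field of `x`-coordinates has fixing group `{1, ι}`.**  In the situation of the main
theorems (`L` the `ℓ`-division field: `hL`, `hLf`; `ι` acting as `-1`), let `E/K` be a normal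
subextension of `K̄` such that `σ|_E = 1` iff `σ` fixes the `x`-coordinate of every non-zero
point of `E[ℓ]` (`hEx`; e.g. `E = K(x(E[ℓ]))`).  Then `σ|_E = 1 ↔ σ|_L ∈ {1, ι}`: an
automorphism fixing all `x(T)` maps each `T` to `±T` (`smul_eq_or_smul_eq_neg_of_smul_x_eq`),
hence is `±1` on `E[ℓ]` (`forall_smul_eq_neg_of_forall_smul_eq_or`), i.e. restricts to `1` or
to `ι` on `L`; conversely `1` and `ι` fix the `x`-coordinates (`smul_coord_of_smul_eq_neg`).  This
is the hypothesis `hkerE` of `swanConductorAt_torsion_eq_two_mul_herbrandPhi_quotient`.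
[cite: SilvermanAEC2009, III.2.3] -/
theorem absRestrictNormalHom_eq_one_iff_of_forall_x [W.IsElliptic] (hℓ2 : ℓ ≠ 2)
    (L : IntermediateField K (AlgebraicClosure K)) [FiniteDimensional K L] [Normal K L]
    (hL : ∀ σ : absoluteGaloisGroup K, absRestrictNormalHom L σ = 1 →
      ∀ T : geomTorsion W ℓ, σ • T = T)
    (hLf : ∀ σ : absoluteGaloisGroup K, (∀ T : geomTorsion W ℓ, σ • T = T) →
      absRestrictNormalHom L σ = 1)
    {ι : L ≃ₐ[K] L}
    (hι : ∀ σ : absoluteGaloisGroup K, absRestrictNormalHom L σ = ι →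
      ∀ T : geomTorsion W ℓ, σ • T = -T)
    (E : IntermediateField K (AlgebraicClosure K)) [Normal K E]
    (hEx : ∀ σ : absoluteGaloisGroup K, absRestrictNormalHom E σ = 1 ↔
      ∀ (T : geomTorsion W ℓ) (x y : AlgebraicClosure K)
        (h : (W.baseChange (AlgebraicClosure K)).toAffine.Nonsingular x y),
        (T : geomPoints W) = Affine.Point.some x y h → σ • x = x)
    (σ : absoluteGaloisGroup K) :
    absRestrictNormalHom E σ = 1 ↔ absRestrictNormalHom L σ = 1 ∨ absRestrictNormalHom L σ = ι := by
  constructor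
  · intro hσE
    have hx := (hEx σ).mp hσE
    -- `σ T = ± T` for every `T`
    have hpm : ∀ T : geomTorsion W ℓ, σ • T = T ∨ σ • T = -T := by
      intro T
      by_cases hT0 : (T : geomPoints W) = 0
      · left
        apply Subtype.ext
        change σ • (T : geomPoints W) = (T : geomPoints W)
        rw [hT0, smul_zero]
      · -- an affine point
        obtain ⟨x, y, h, hT⟩ : ∃ x y h, (T : geomPoints W) = Affine.Point.some x y h := by
          rcases hTp : (show (W.baseChange (AlgebraicClosure K)).toAffine.Point from
              (T : geomPoints W)) with _ | ⟨x, y, h⟩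
          · exact absurd (hTp : (T : geomPoints W) = 0) hT0
          · exact ⟨x, y, h, hTp⟩
        exact W.smul_eq_or_smul_eq_neg_of_smul_x_eq ℓ hT (hx T x y h hT)
    rcases W.forall_smul_eq_neg_of_forall_smul_eq_or ℓ hℓ2 hpm with hall | hall
    · exact Or.inl (hLf σ hall)
    · right
      obtain ⟨τ, hτ⟩ := absRestrictNormalHom_surjective' L ι
      have hτneg := hι τ hτ
      have hfix : ∀ T : geomTorsion W ℓ, (τ⁻¹ * σ) • T = T := by
        intro T
        rw [mul_smul, hall T, smul_neg, W.inv_smul_eq_neg_of_smul_eq_neg ℓ hτneg T, neg_neg]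
      have h1 := hLf _ hfix
      rw [map_mul, map_inv, hτ, inv_mul_eq_one] at h1
      exact h1.symm
  · intro hσL
    refine (hEx σ).mpr fun T x y h hT => ?_
    rcases hσL with h1 | h1
    · exact (W.smul_coord_of_smul_eq ℓ (hL σ h1 T) hT).1
    · exact (W.smul_coord_of_smul_eq_neg ℓ (hι σ h1 T) hT).1

/-- **`G_i(𝔓 ∩ L)` moves `E[ℓ]` iff `i ≤ b`**, for `i ≥ 1`, in the situation of
`mem_zpowers_of_mem_ramificationSubgroup_one` with `i_G(ι) = b + 1`: `G_i` moves `E[ℓ]` iff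
`G_i ≠ 1` (faithfulness) iff `ι ∈ G_i` (`ramificationSubgroup_ne_bot_iff_mem_of_forall_mem_zpowers`)
iff `i ≤ b`.  [cite: SerreLocalFields1979, Ch. IV §1 (p. 62)] -/
theorem exists_smul_geomTorsion_ne_iff_le [W.IsElliptic]
    {v : HeightOneSpectrum (𝓞 K)} (hv2 : (2 : 𝓞 K) ∈ v.asIdeal) (hℓ : (ℓ : 𝓞 K) ∉ v.asIdeal)
    {𝔓 : Ideal (absIntegers (𝓞 K) K)} (h𝔓 : 𝔓 ∈ v.primesAbove)
    (L : IntermediateField K (AlgebraicClosure K)) [FiniteDimensional K L] [Normal K L]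
    (hL : ∀ σ : absoluteGaloisGroup K, absRestrictNormalHom L σ = 1 →
      ∀ T : geomTorsion W ℓ, σ • T = T)
    (hLf : ∀ σ : absoluteGaloisGroup K, (∀ T : geomTorsion W ℓ, σ • T = T) →
      absRestrictNormalHom L σ = 1)
    {ι : L ≃ₐ[K] L}
    (hι : ∀ σ : absoluteGaloisGroup K, absRestrictNormalHom L σ = ι →
      ∀ T : geomTorsion W ℓ, σ • T = -T)
    {b : ℕ} (hb : lowerIndex (𝔓.comap (L.integralClosureToAbsIntegers (𝓞 K))) (L ≃ₐ[K] L) ι =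
      b + 1)
    {i : ℕ} (hi : 1 ≤ i) :
    (∃ σ : absoluteGaloisGroup K, absRestrictNormalHom L σ ∈
        (𝔓.comap (L.integralClosureToAbsIntegers (𝓞 K))).ramificationSubgroup (L ≃ₐ[K] L) i ∧
        ∃ T : geomTorsion W ℓ, σ • T ≠ T) ↔ i ≤ b := by
  have hprime : ℓ.Prime := Fact.out
  have hℓ2 : ℓ ≠ 2 := by
    rintro rfl
    exact hℓ (by exact_mod_cast hv2)
  have hι1 : ι ≠ 1 := W.ne_one_of_smul_eq_neg ℓ hℓ2 L hL hι
  have hgen := W.mem_zpowers_of_mem_ramificationSubgroup_one ℓ hv2 hℓ h𝔓 L hL hLf hι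
  rw [← ramificationSubgroup_ne_bot_iff_le_of_lowerIndex_eq _ hι1 hgen hb hi,
    ramificationSubgroup_ne_bot_iff_mem_of_forall_mem_zpowers _ hι1 hgen hi]
  constructor
  · rintro ⟨σ, hσ, T, hT⟩
    -- `σ|_L ≠ 1`, so `G_i ≠ 1`, so `ι ∈ G_i`
    have hne : (𝔓.comap (L.integralClosureToAbsIntegers (𝓞 K))).ramificationSubgroup
        (L ≃ₐ[K] L) i ≠ ⊥ := by
      intro hbot
      rw [hbot, Subgroup.mem_bot] at hσ
      exact hT (hL σ hσ T)
    exact (ramificationSubgroup_ne_bot_iff_mem_of_forall_mem_zpowers _ hι1 hgen hi).mp hne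
  · intro hιi
    obtain ⟨τ, hτ⟩ := absRestrictNormalHom_surjective' L ι
    haveI : Finite (geomTorsion W ℓ) := W.finite_geomTorsion_nat hprime.ne_zero
    haveI : Module.Finite (ZMod ℓ) (geomTorsion W ℓ) := Module.Finite.of_finite
    have hℓK : (ℓ : K) ≠ 0 := Nat.cast_ne_zero.mpr hprime.ne_zero
    obtain ⟨T, hT0⟩ : ∃ T : geomTorsion W ℓ, T ≠ 0 := by
      rw [← Module.finrank_pos_iff_exists_ne_zero (R := ZMod ℓ),
        W.finrank_geomTorsion_eq_two ℓ hℓK]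
      exact Nat.zero_lt_two
    refine ⟨τ, hτ ▸ hιi, T, fun hfix => hT0 ?_⟩
    have hneg := hι τ hτ T
    rw [hfix] at hneg
    exact W.geomTorsion_eq_zero_of_eq_neg ℓ hℓ2 hneg

/-- **`Sw_𝔓(V_ℓ E) = 2 φ_{L/K}(b)`** — the wild conductor above `2` from the index of the central
involution.  Let `E/K` be an elliptic curve over a number field, `ℓ` a prime, `v` a finite place
with `2 ∈ v` and `ℓ ∉ v`, `𝔓 ∣ v` a prime of `\bar ℤ_K`, `L/K` a finite normal subextension of
`K̄` with `σ|_L = 1 ↔ σ` fixes `E[ℓ]` (`hL`, `hLf`), `ι ∈ Gal(L/K)` acting as `-1` on `E[ℓ]`,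
and `i_{Gal(L/K)}(ι) = b + 1` at `𝔓 ∩ L`.  Then the Swan conductor of `V_ℓ E` at `𝔓` is
`2 φ_{L/K}(b)`, `φ_{L/K}` the Herbrand function of `Gal(L/K)` at `𝔓 ∩ L`: in
`Sw = Σ_{i ≥ 1} (g_i/g_0) codim E[ℓ]^{G_i}` (*ATAEC* §IV.10, `swanConductorAt_rationalTate_eq_finsum_ite`)
the summand is `2 g_i/g_0` for `i ≤ b` and `0` beyond (`exists_smul_geomTorsion_ne_iff_le`), and
`Σ_{i=1}^{b} g_i = g_0 φ(b)` (Serre IV §3).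
[cite: SilvermanATAEC1994, §IV.10 Definition of δ (PDF p. 358) and proof of Thm. IV.11.1 (p. 370)]
[cite: SerreLocalFields1979, Ch. IV §3 (p. 73: φ(m) + 1 = (1/g₀) Σ_{i ≤ m} g_i)] -/
theorem swanConductorAt_rationalTate_eq_two_mul_herbrandPhi [W.IsElliptic]
    (h : Continuous fun x : absoluteGaloisGroup K × RationalTateModule (geomPoints W) ℓ ↦
      rationalTateRepresentation (absoluteGaloisGroup K) (geomPoints W) ℓ x.1 x.2)
    {v : HeightOneSpectrum (𝓞 K)} (hv2 : (2 : 𝓞 K) ∈ v.asIdeal) (hℓ : (ℓ : 𝓞 K) ∉ v.asIdeal)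
    {𝔓 : Ideal (absIntegers (𝓞 K) K)} (h𝔓 : 𝔓 ∈ v.primesAbove)
    (L : IntermediateField K (AlgebraicClosure K)) [FiniteDimensional K L] [Normal K L]
    (hL : ∀ σ : absoluteGaloisGroup K, absRestrictNormalHom L σ = 1 →
      ∀ T : geomTorsion W ℓ, σ • T = T)
    (hLf : ∀ σ : absoluteGaloisGroup K, (∀ T : geomTorsion W ℓ, σ • T = T) →
      absRestrictNormalHom L σ = 1)
    {ι : L ≃ₐ[K] L}
    (hι : ∀ σ : absoluteGaloisGroup K, absRestrictNormalHom L σ = ι →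
      ∀ T : geomTorsion W ℓ, σ • T = -T)
    {b : ℕ} (hb : lowerIndex (𝔓.comap (L.integralClosureToAbsIntegers (𝓞 K))) (L ≃ₐ[K] L) ι =
      b + 1) :
    (rationalTateGaloisRepOf (geomPoints W) ℓ h).swanConductorAt (𝓞 K) 𝔓 =
      2 * herbrandPhi (𝔓.comap (L.integralClosureToAbsIntegers (𝓞 K))) (L ≃ₐ[K] L) b := by
  haveI : IsGalois K L := {}
  rw [W.swanConductorAt_rationalTate_eq_finsum_ite ℓ h hℓ h𝔓 L hL]
  set 𝔓L := 𝔓.comap (L.integralClosureToAbsIntegers (𝓞 K)) with h𝔓L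
  set g₀ : ℝ := ((Nat.card (𝔓L.ramificationSubgroup (L ≃ₐ[K] L) 0) : ℕ) : ℝ) with hg₀
  have hg₀pos : 0 < g₀ := by rw [hg₀]; exact_mod_cast Nat.card_pos
  have hterm : ∀ i : ℕ,
      ((Nat.card (𝔓L.ramificationSubgroup (L ≃ₐ[K] L) (i + 1)) : ℕ) : ℝ) / g₀ *
          (if (∃ σ : absoluteGaloisGroup K, absRestrictNormalHom L σ ∈
              𝔓L.ramificationSubgroup (L ≃ₐ[K] L) (i + 1) ∧ ∃ T : geomTorsion W ℓ, σ • T ≠ T)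
            then (2 : ℝ) else 0) =
        (if i + 1 ≤ b then
          2 * (((Nat.card (𝔓L.ramificationSubgroup (L ≃ₐ[K] L) (i + 1)) : ℕ) : ℝ) / g₀)
          else 0) := by
    intro i
    by_cases hib : i + 1 ≤ b
    · rw [if_pos ((W.exists_smul_geomTorsion_ne_iff_le ℓ hv2 hℓ h𝔓 L hL hLf hι hb
        (Nat.le_add_left 1 i)).mpr hib), if_pos hib]
      ring
    · rw [if_neg (fun hc ↦ hib ((W.exists_smul_geomTorsion_ne_iff_le ℓ hv2 hℓ h𝔓 L hL hLf hι hb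
        (Nat.le_add_left 1 i)).mp hc)), if_neg hib, mul_zero]
  simp_rw [hterm]
  rw [finsum_eq_sum_of_support_subset (s := Finset.range b)]
  · rw [Finset.sum_ite, Finset.sum_const_zero, add_zero]
    have hfilter : (Finset.range b).filter (fun i ↦ i + 1 ≤ b) = Finset.range b := by
      ext i; simp only [Finset.mem_filter, Finset.mem_range]; omega
    rw [hfilter]
    -- `Σ_{i<b} g_{i+1} = g₀ φ(b)`
    have hphi := card_mul_herbrandPhi_natCast_add_one 𝔓L (L ≃ₐ[K] L) b
    rw [Finset.sum_range_succ'] at hphi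
    have hsum : (∑ i ∈ Finset.range b,
        2 * (((Nat.card (𝔓L.ramificationSubgroup (L ≃ₐ[K] L) (i + 1)) : ℕ) : ℝ) / g₀)) =
        2 / g₀ * ∑ i ∈ Finset.range b,
          ((Nat.card (𝔓L.ramificationSubgroup (L ≃ₐ[K] L) (i + 1)) : ℕ) : ℝ) := by
      rw [Finset.mul_sum]
      refine Finset.sum_congr rfl fun i _ => ?_
      ring
    rw [hsum]
    rw [hg₀] at hg₀pos ⊢
    field_simp
    linarith
  · intro i hi
    rw [Function.mem_support] at hi
    simp only [Finset.coe_range, Set.mem_Iio]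
    by_contra h'
    exact hi (if_neg (by omega))

/-- **`Sw_𝔓(E[ℓ]) = 2 φ_{L/K}(b)`** — torsion form of
`swanConductorAt_rationalTate_eq_two_mul_herbrandPhi` (`Sw_𝔓(V_ℓ E) = Sw_𝔓(E[ℓ])`, Serre–Tate §3,
`swanConductorAt_rationalTate_eq_swanConductorAt_torsion`, with the continuity of `V_ℓ E`,
`continuous_rationalGaloisRepTate_holds`).
[cite: SilvermanATAEC1994, §IV.10 Definition of δ (PDF p. 358) and proof of Thm. IV.11.1 (p. 370)]
[cite: SerreTate1968, §3] -/
theorem swanConductorAt_torsion_eq_two_mul_herbrandPhi [W.IsElliptic]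
    {v : HeightOneSpectrum (𝓞 K)} (hv2 : (2 : 𝓞 K) ∈ v.asIdeal) (hℓ : (ℓ : 𝓞 K) ∉ v.asIdeal)
    {𝔓 : Ideal (absIntegers (𝓞 K) K)} (h𝔓 : 𝔓 ∈ v.primesAbove)
    (L : IntermediateField K (AlgebraicClosure K)) [FiniteDimensional K L] [Normal K L]
    (hL : ∀ σ : absoluteGaloisGroup K, absRestrictNormalHom L σ = 1 →
      ∀ T : geomTorsion W ℓ, σ • T = T)
    (hLf : ∀ σ : absoluteGaloisGroup K, (∀ T : geomTorsion W ℓ, σ • T = T) →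
      absRestrictNormalHom L σ = 1)
    {ι : L ≃ₐ[K] L}
    (hι : ∀ σ : absoluteGaloisGroup K, absRestrictNormalHom L σ = ι →
      ∀ T : geomTorsion W ℓ, σ • T = -T)
    {b : ℕ} (hb : lowerIndex (𝔓.comap (L.integralClosureToAbsIntegers (𝓞 K))) (L ≃ₐ[K] L) ι =
      b + 1) :
    (W.torsionGaloisRep ℓ).swanConductorAt (𝓞 K) 𝔓 =
      2 * herbrandPhi (𝔓.comap (L.integralClosureToAbsIntegers (𝓞 K))) (L ≃ₐ[K] L) b := by
  have h := W.continuous_rationalGaloisRepTate_holds ℓ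
  rw [← W.swanConductorAt_rationalTate_eq_swanConductorAt_torsion ℓ h hℓ h𝔓]
  exact W.swanConductorAt_rationalTate_eq_two_mul_herbrandPhi ℓ h hv2 hℓ h𝔓 L hL hLf hι hb

/-! ### Through the quotient `E = L^ι` (the field of `x`-coordinates) -/

/-- **`Sw_𝔓(E[ℓ]) = 2 φ_{E/K}(b)`**: in the situation of
`swanConductorAt_torsion_eq_two_mul_herbrandPhi`, let `E ≤ L` be a normal subextension of `K̄/K`
with `σ|_E = 1 ↔ σ|_L ∈ {1, ι}` (the field `K(x(E[ℓ]))` of `x`-coordinates, fixed field of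
`[-1]`).  Then the Swan conductor of `E[ℓ]` at `𝔓` is `2 φ_{E/K}(b)` with `φ_{E/K}` the Herbrand
function of `Gal(E/K)` at `𝔓 ∩ E` — Serre's Prop. 15 `φ_{L/K} = φ_{E/K} ∘ φ_{L/E}` with
`φ_{L/E}(b) = b` (`herbrandPhi_eq_herbrandPhi_quotient_of_lowerIndex_eq`), transported from the
copy of `E` inside `L` (`RamificationFiltrationTowerProofs`).  Hence the wild conductor above `2`
is computed in the `x`-coordinate field: `#Q₀ · φ_{E/K}(b) = b + Σ_{τ ∈ Q₁ ∖ 1} (i_Q(τ) - 1)`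
(`card_mul_herbrandPhi_eq_of_lowerIndex_eq_of_wild`, `Q = Gal(E/K)`).
[cite: SilvermanATAEC1994, §IV.10 Definition of δ (PDF p. 358) and Thm. IV.11.1, p = 2 (p. 366)]
[cite: SerreLocalFields1979, Ch. IV §3 Prop. 15 (pp. 75–76)] -/
theorem swanConductorAt_torsion_eq_two_mul_herbrandPhi_quotient [W.IsElliptic]
    {v : HeightOneSpectrum (𝓞 K)} (hv2 : (2 : 𝓞 K) ∈ v.asIdeal) (hℓ : (ℓ : 𝓞 K) ∉ v.asIdeal)
    {𝔓 : Ideal (absIntegers (𝓞 K) K)} (h𝔓 : 𝔓 ∈ v.primesAbove)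
    (L : IntermediateField K (AlgebraicClosure K)) [FiniteDimensional K L] [Normal K L]
    (hL : ∀ σ : absoluteGaloisGroup K, absRestrictNormalHom L σ = 1 →
      ∀ T : geomTorsion W ℓ, σ • T = T)
    (hLf : ∀ σ : absoluteGaloisGroup K, (∀ T : geomTorsion W ℓ, σ • T = T) →
      absRestrictNormalHom L σ = 1)
    {ι : L ≃ₐ[K] L}
    (hι : ∀ σ : absoluteGaloisGroup K, absRestrictNormalHom L σ = ι →
      ∀ T : geomTorsion W ℓ, σ • T = -T)
    {b : ℕ} (hb : lowerIndex (𝔓.comap (L.integralClosureToAbsIntegers (𝓞 K))) (L ≃ₐ[K] L) ι =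
      b + 1)
    (E : IntermediateField K (AlgebraicClosure K)) [FiniteDimensional K E] [Normal K E]
    (hle : E ≤ L)
    (hkerE : ∀ σ : absoluteGaloisGroup K, absRestrictNormalHom E σ = 1 ↔
      absRestrictNormalHom L σ = 1 ∨ absRestrictNormalHom L σ = ι) :
    (W.torsionGaloisRep ℓ).swanConductorAt (𝓞 K) 𝔓 =
      2 * herbrandPhi (𝔓.comap (E.integralClosureToAbsIntegers (𝓞 K))) (E ≃ₐ[K] E) b := by
  haveI : 𝔓.IsPrime := h𝔓.1
  haveI h𝔓max : 𝔓.IsMaximal := HeightOneSpectrum.isMaximal_of_mem_primesAbove h𝔓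
  haveI : IsGalois K L := {}
  rw [W.swanConductorAt_torsion_eq_two_mul_herbrandPhi ℓ hv2 hℓ h𝔓 L hL hLf hι hb]
  congr 1
  -- the copy `restrict hle` of `E` inside `L`; instances at `𝔓 ∩ L`
  haveI : Normal K (IntermediateField.restrict hle) :=
    Normal.of_algEquiv (IntermediateField.restrict_algEquiv hle)
  set 𝔓L := 𝔓.comap (L.integralClosureToAbsIntegers (𝓞 K)) with h𝔓L
  haveI hmaxL : 𝔓L.IsMaximal := isMaximal_comap_integralClosureToAbsIntegers (𝓞 K) 𝔓 L
  haveI : Finite ((𝓞 K) ⧸ 𝔓.under (𝓞 K)) := by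
    rw [← h𝔓.2.over]
    exact Ideal.finiteQuotientOfFreeOfNeBot v.asIdeal v.ne_bot
  haveI hsepL : Algebra.IsSeparable ((𝓞 K) ⧸ 𝔓L.under (𝓞 K)) (integralClosure (𝓞 K) L ⧸ 𝔓L) :=
    isSeparable_residue_comap (𝓞 K) 𝔓 L
  -- the kernel of `Gal(L/K) → Gal(restrict hle/K)` is `{1, ι}`
  have hker : ∀ g : L ≃ₐ[K] L,
      AlgEquiv.restrictNormalHom (IntermediateField.restrict hle) g = 1 ↔ g = 1 ∨ g = ι := by
    intro g
    obtain ⟨σ, rfl⟩ := absRestrictNormalHom_surjective' L g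
    rw [restrictNormalHom_restrict_absRestrictNormalHom hle σ, ← hkerE σ,
      MulEquiv.map_eq_one_iff]
  -- Prop. 15 through the quotient by `{1, ι}` (instances passed explicitly: the `𝓞 K`-algebra
  -- structure on `L` hidden in `integralClosure` is `IntermediateField.algebra'`)
  have key : herbrandPhi 𝔓L (L ≃ₐ[K] L) b =
      herbrandPhi (𝔓L.comap ((IntermediateField.restrict hle).integralClosureInclusion (𝓞 K)))
        (IntermediateField.restrict hle ≃ₐ[K] IntermediateField.restrict hle) b :=
    @herbrandPhi_eq_herbrandPhi_quotient_of_lowerIndex_eq (𝓞 K) K L _ _ _ _ _ _ _ _ _ _ _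
      (IntermediateField.restrict hle) _ 𝔓L hmaxL hsepL ι hker b hb
  rw [key]
  -- transport to `E`
  rw [← comap_restrict_mapIntegralClosure (𝓞 K) hle 𝔓]
  exact (congrFun (herbrandPhi_comap_ringEquiv
    (((IntermediateField.restrict_algEquiv hle).restrictScalars (𝓞 K)).mapIntegralClosure.toRingEquiv)
    ((IntermediateField.restrict_algEquiv hle).autCongr).toMonoidHom
    (restrict_mapIntegralClosure_smul (𝓞 K) hle)
    ((IntermediateField.restrict_algEquiv hle).autCongr).bijective _) (b : ℝ)).symm

end NumberField

end WeierstrassCurve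

end
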